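import Literature.AlgebraicGeometry.Frobenioids.Composites
import Mathlib.CategoryTheory.Widesubcategory
import Mathlib.CategoryTheory.Comma.Over.Basic
import HarnessLib

/-!
# Frobenioids I, Proposition 1.9 (Isotropic Objects and Isometries), parts (i), (iv), (vi), (vii)

Mochizuki, *The geometry of Frobenioids I: the general theory*, Kyushu J. Math. **62** (2008)
293–400, §1, Proposition 1.9 and its proof, kurims text pp. 30–34
[cite: MochizukiFrdI2008, Prop. 1.9]. Standing data: `Φ` a divisorial monoid on a connected,
totally epimorphic category `D`, `C → F_Φ` a Frobenioid (hypothesis `hF : IsFrobenioid F`).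

> "Write `C^imtr-pre ⊆ C` for the subcategory determined by the isometric pre-steps and
> `C^imtr-pre_A := (C^imtr-pre)_A` for `A ∈ Ob(C)`. Then:
> (i) Any base-isomorphism `φ : A → B` of `C` admits a factorization `φ = α ∘ β` where `α` is an
> isometric pre-step, and `β` is a co-angular base-isomorphism; this factorization is unique, up
> to replacing the pair `(α, β)` by a pair of the form `(α ∘ γ, γ⁻¹ ∘ β)`, where `γ` is an
> isomorphism of `C`. Here, `φ` is isometric if and only if `β` is a morphism of Frobenius type;
> `φ` is co-angular if and only if `α` is an isomorphism; `φ` is a pull-back morphism if and only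
> if `φ` is an isomorphism. …
> (iv) Let `φ : A → B` be a co-angular linear morphism [e.g., a pull-back morphism]. Then `A` is
> isotropic if and only if `B` is. …
> (vi) A morphism of `C` is an isotropic hull if and only if its codomain is isotropic, and,
> moreover, it is minimal-coadjoint to the morphisms with isotropic domain.
> (vii) A morphism `A → B` of `C` is an isometric pre-step if and only if the composite of this
> morphism `A → B` with an isotropic hull `B → C` yields an isotropic hull `A → C`."

Everything here is PROVED, following the printed proof (p. 32 for (i); p. 33 for (iv); pp. 33–34
for (vi), (vii)). Parts (ii), (iii) (the functors `φ_*`, `φ^*` on `C^imtr-pre_A`) and (v)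
(`C^istr` is a Frobenioid; the isotropification functor) are in the companion files
`IsometricPreStepsPushforward.lean`, `IsometricPreStepsPullback.lean` and `IsotropicSubcategory.lean`
/ `IsotropicFrobenioid.lean` / `Isotropification.lean`.

Renderings (recorded for the referee). Composition is diagrammatic (`β ≫ α` is the text's
`α ∘ β`). `C^imtr-pre` is Mathlib's `WideSubcategory` of the class of isometric pre-steps (closed
under composition and containing identities formally, Remark 1.1.1), `C^imtr-pre_A` is `Over`.
(i) "unique up to `(α ∘ γ, γ⁻¹ ∘ β)`" ↦ any two factorisations are related by an isomorphism `γ`;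
the three "iff"s are stated for a given factorisation. (vii) "the composite with an isotropic hull
`B → C` yields an isotropic hull" ↦ for EVERY isotropic hull `B → C` (hulls exist and are unique
up to isomorphism in a Frobenioid, Def. 1.3 (vii)(a), so "some" and "every" agree; the "some"
direction is `isIsometricPreStep_of_comp_isIsotropicHull`). No statement of the paper is
strengthened.
-/

namespace Literature.AlgebraicGeometry.Frobenioids

open CategoryTheory Opposite

universe w v v' u u'

namespace PreFrobenioid

variable {D : Type u} [Category.{v} D] {Φ : Dᵒᵖ ⥤ CommMonCat.{w}}
  {C : Type u'} [Category.{v'} C] (F : C ⥤ ElemFrobenioid Φ)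

/-! ### The subcategory `C^imtr-pre` of isometric pre-steps (p. 31) -/

/-- An *isometric pre-step*: an isometry that is a pre-step (FrdI Def. 1.2 (i), (iii); the arrows
of `C^imtr-pre`, Prop. 1.9). [cite: MochizukiFrdI2008, Prop. 1.9 p.31] -/
def IsIsometricPreStep {A B : C} (φ : A ⟶ B) : Prop := IsIsometry F φ ∧ IsPreStep F φ

/-- `C^imtr-pre`: the class of isometric pre-steps (FrdI Prop. 1.9, p. 31).
[cite: MochizukiFrdI2008, Prop. 1.9 p.31] -/
def isometricPreSteps : MorphismProperty C := fun _ _ φ => IsIsometricPreStep F φ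

/-- The identity is an isometric pre-step (Remark 1.1.1). [cite: MochizukiFrdI2008, Prop. 1.9 p.31] -/
theorem isIsometricPreStep_id (A : C) : IsIsometricPreStep F (𝟙 A) :=
  ⟨div_id F A, isPreStep_of_isIso F (𝟙 A)⟩

/-- Isometric pre-steps are closed under composition (Remark 1.1.1; cf. Prop. 1.7 (i)).
[cite: MochizukiFrdI2008, Prop. 1.9 p.31] -/
theorem IsIsometricPreStep.comp {X Y Z : C} {f : X ⟶ Y} {g : Y ⟶ Z} (hf : IsIsometricPreStep F f)
    (hg : IsIsometricPreStep F g) : IsIsometricPreStep F (f ≫ g) :=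
  ⟨IsIsometry.comp F hf.1 hg.1, IsPreStep.comp F hf.2 hg.2⟩

/-- `C^imtr-pre` contains the identities and is stable under composition, so that it is a (wide)
subcategory of `C` (FrdI Prop. 1.9, p. 31). [cite: MochizukiFrdI2008, Prop. 1.9 p.31] -/
instance isometricPreSteps_isMultiplicative : (isometricPreSteps F).IsMultiplicative where
  id_mem A := isIsometricPreStep_id F A
  comp_mem _ _ hf hg := IsIsometricPreStep.comp F hf hg

/-- The category `C^imtr-pre ⊆ C` determined by the isometric pre-steps (FrdI Prop. 1.9, p. 31);
`C^imtr-pre_A` is `Over (⟨A⟩ : ImtrPreCat F)`. [cite: MochizukiFrdI2008, Prop. 1.9 p.31] -/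
abbrev ImtrPreCat : Type u' := WideSubcategory (isometricPreSteps F)

variable {F}

/-- Two-out-of-three for isometric pre-steps, composite and second factor given: if `f ≫ g` and
`g` are isometric pre-steps then so is `f` (Prop. 1.7 (v) for pre-steps and isometries: "if any two
of the three morphisms `α, β, γ` is an isometric pre-step, then the same is true of the remaining
morphism", p. 34). [cite: MochizukiFrdI2008, Prop. 1.9 p.34] -/
theorem IsIsometricPreStep.of_comp_right (hP : IsPreFrobenioid Φ F) {X Y Z : C} {f : X ⟶ Y}
    {g : Y ⟶ Z} (hfg : IsIsometricPreStep F (f ≫ g)) : IsIsometricPreStep F f :=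
  ⟨(isIsometry_factors F hP hfg.1).2, (isPreStep_factors F hP.isTotallyEpimorphic_base hfg.2).2⟩

/-- Two-out-of-three for isometric pre-steps, composite and first factor given: if `f ≫ g` and `f`
are isometric pre-steps then so is `g` (p. 34; for the isometry of `g` one uses the injectivity of
the pull-back map `Base(f)^*`, Def. 1.1 (ii)(a)). [cite: MochizukiFrdI2008, Prop. 1.9 p.34] -/
theorem IsIsometricPreStep.of_comp_left (hP : IsPreFrobenioid Φ F) {X Y Z : C} {f : X ⟶ Y}
    {g : Y ⟶ Z} (hfg : IsIsometricPreStep F (f ≫ g)) : IsIsometricPreStep F g :=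
  ⟨(isIsometry_factors F hP hfg.1).1, (isPreStep_factors F hP.isTotallyEpimorphic_base hfg.2).1⟩

/-- In a Frobenioid an isomorphism is an isometric pre-step. [cite: MochizukiFrdI2008, Prop. 1.9 p.31] -/
theorem isIsometricPreStep_of_isIso (hP : IsPreFrobenioid Φ F) {A B : C} (φ : A ⟶ B) [IsIso φ] :
    IsIsometricPreStep F φ :=
  ⟨isIsometry_of_isIso F hP φ, isPreStep_of_isIso F φ⟩

/-- Morphisms of `C^imtr-pre_A` are unique when they exist: in a Frobenioid pre-steps are
monomorphisms (Def. 1.3 (v)(a)), so `C^imtr-pre_A` is a preorder (used on p. 33: "since every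
pre-step is a monomorphism … it follows immediately that `φ_*` is faithful").
[cite: MochizukiFrdI2008, Prop. 1.9 p.33] -/
theorem subsingleton_hom_over_imtrPre (hF : IsFrobenioid F) {A : C}
    (U V : Over (⟨A⟩ : ImtrPreCat F)) : Subsingleton (U ⟶ V) := by
  refine ⟨fun m m' => ?_⟩
  haveI : Mono V.hom.1 := hF.v_a V.hom.1 V.hom.2.2
  have hm : m.left.1 ≫ V.hom.1 = U.hom.1 := congrArg InducedWideCategory.Hom.hom (Over.w m)
  have hm' : m'.left.1 ≫ V.hom.1 = U.hom.1 := congrArg InducedWideCategory.Hom.hom (Over.w m')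
  exact Over.OverMorphism.ext (InducedWideCategory.Hom.ext
    ((cancel_mono V.hom.1).mp (hm.trans hm'.symm)))

/-! ### Proposition 1.9 (i) -/

/-- **Prop. 1.9 (i)**, existence: a base-isomorphism `φ` factors as `φ = α ∘ β` (`β ≫ α`) with
`β` a co-angular base-isomorphism and `α` an isometric pre-step (from the factorisation of
Def. 1.3 (iv)(a), in which the pull-back morphism is a base-isomorphism, hence an isomorphism
[Remark 1.2.1], followed by the factorisation of pre-steps of Def. 1.3 (v)(b), and the closedness
of co-angular morphisms under composition). [cite: MochizukiFrdI2008, Prop. 1.9(i) p.31] -/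
theorem exists_coAngular_isometricPreStep_factorization (hF : IsFrobenioid F) {A B : C}
    (φ : A ⟶ B) (hφ : IsBaseIso F φ) :
    ∃ (X : C) (β : A ⟶ X) (α : X ⟶ B), β ≫ α = φ ∧ (IsCoAngular F β ∧ IsBaseIso F β) ∧
      IsIsometricPreStep F α := by
  have hD : IsTotallyEpimorphic D := hF.isPreFrobenioid.isTotallyEpimorphic_base
  have hC : IsTotallyEpimorphic C := hF.isPreFrobenioid.isTotallyEpimorphic
  obtain ⟨X, Y, γ, β₀, α₀, hfac, hγ, hβ₀, hα₀⟩ := hF.iv_a_exists φ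
  -- `α₀` is a pull-back morphism and a base-isomorphism, hence an isomorphism
  have hα₀b : IsBaseIso F α₀ := by
    have h : IsBaseIso F (γ ≫ β₀ ≫ α₀) := by rw [hfac]; exact hφ
    exact (isBaseIso_factors F hD (isBaseIso_factors F hD h).1).1
  haveI : IsIso α₀ := (isPullbackMorphism_and_isBaseIso_iff_isIso F α₀).mp ⟨hα₀, hα₀b⟩
  -- factor the pre-step `β₀ ≫ α₀` as co-angular pre-step followed by isometric pre-step
  have hβα : IsPreStep F (β₀ ≫ α₀) := IsPreStep.comp F hβ₀ (isPreStep_of_isIso F α₀)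
  obtain ⟨X', β₁, α₁, hfac₁, hβ₁, hα₁⟩ := hF.v_b_exists (β₀ ≫ α₀) hβα
  refine ⟨X', γ ≫ β₁, α₁, ?_, ⟨IsCoAngular.comp F hF hγ.1.1 hβ₁.1, IsBaseIso.comp F hγ.2 hβ₁.2.2⟩,
    hα₁⟩
  rw [Category.assoc, hfac₁, hfac]

/-- **Prop. 1.9 (i)**, uniqueness: two factorisations `φ = α ∘ β = α' ∘ β'` of a base-isomorphism
with `β, β'` co-angular base-isomorphisms and `α, α'` isometric pre-steps differ by an isomorphism
`γ`: `β' = γ⁻¹ ∘ β`-style, i.e. `β ≫ γ = β'` and `α = γ ≫ α'` (via the essential uniqueness of the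
factorisations of Def. 1.3 (iv)(a) and (v)(b) and Prop. 1.4 (iv)).
[cite: MochizukiFrdI2008, Prop. 1.9(i) p.31] -/
theorem coAngular_isometricPreStep_factorization_unique (hF : IsFrobenioid F) {A B X X' : C}
    (φ : A ⟶ B) (β : A ⟶ X) (α : X ⟶ B) (β' : A ⟶ X') (α' : X' ⟶ B)
    (hfac : β ≫ α = φ) (hβ : IsCoAngular F β ∧ IsBaseIso F β) (hα : IsIsometricPreStep F α)
    (hfac' : β' ≫ α' = φ) (hβ' : IsCoAngular F β' ∧ IsBaseIso F β') (hα' : IsIsometricPreStep F α') :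
    ∃ γ : X ≅ X', β ≫ γ.hom = β' ∧ α = γ.hom ≫ α' := by
  have hP : IsPreFrobenioid Φ F := hF.isPreFrobenioid
  have hD : IsTotallyEpimorphic D := hP.isTotallyEpimorphic_base
  have hC : IsTotallyEpimorphic C := hP.isTotallyEpimorphic
  -- factor the co-angular base-isomorphisms `β`, `β'` as (Frobenius type) then (co-angular
  -- pre-step), via Def. 1.3 (iv)(a) (the pull-back part is an isomorphism) and Prop. 1.4 (iv)
  have key : ∀ {Z : C} (b : A ⟶ Z), IsCoAngular F b → IsBaseIso F b →
      ∃ (W : C) (g : A ⟶ W) (p : W ⟶ Z), g ≫ p = b ∧ IsFrobeniusType F g ∧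
        IsCoAngularPreStep F p := by
    intro Z b hbco hbb
    obtain ⟨W, Y, g, p₀, a₀, hf, hg, hp₀, ha₀⟩ := hF.iv_a_exists b
    have ha₀b : IsBaseIso F a₀ := by
      have h : IsBaseIso F (g ≫ p₀ ≫ a₀) := by rw [hf]; exact hbb
      exact (isBaseIso_factors F hD (isBaseIso_factors F hD h).1).1
    haveI : IsIso a₀ := (isPullbackMorphism_and_isBaseIso_iff_isIso F a₀).mp ⟨ha₀, ha₀b⟩
    have hp₀co : IsCoAngular F p₀ :=
      (isCoAngular_iff_of_factorization F hF b g p₀ a₀ hf hg hp₀ ha₀).mp hbco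
    refine ⟨W, g, p₀ ≫ a₀, by rw [hf], hg, ⟨hF.iii_a p₀ a₀ hp₀co (isCoAngular_of_isIso F hC a₀),
      IsPreStep.comp F hp₀ (isPreStep_of_isIso F a₀)⟩⟩
  obtain ⟨W, g, p, hgp, hg, hp⟩ := key β hβ.1 hβ.2
  obtain ⟨W', g', p', hgp', hg', hp'⟩ := key β' hβ'.1 hβ'.2
  -- two factorisations of `φ` as in Def. 1.3 (iv)(a) with trivial pull-back part
  have h1 : g ≫ (p ≫ α) ≫ 𝟙 B = φ := by
    rw [Category.comp_id, ← Category.assoc, hgp, hfac]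
  have h2 : g' ≫ (p' ≫ α') ≫ 𝟙 B = φ := by
    rw [Category.comp_id, ← Category.assoc, hgp', hfac']
  obtain ⟨ε, δ, hε, hδ, hδ'⟩ := hF.iv_a_unique φ g (p ≫ α) (𝟙 B) g' (p' ≫ α') (𝟙 B) h1 hg
    (IsPreStep.comp F hp.2 hα.2) (isPullbackMorphism_of_isIso F (𝟙 B)) h2 hg'
    (IsPreStep.comp F hp'.2 hα'.2) (isPullbackMorphism_of_isIso F (𝟙 B))
  have hδ1 : δ.hom = 𝟙 B := by simpa using hδ'.symm
  rw [hδ1, Category.comp_id] at hδ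
  -- `(p, α)` and `(ε ≫ p', α')` are two factorisations of the pre-step `p ≫ α` as in (v)(b)
  have hεp' : IsCoAngularPreStep F (ε.hom ≫ p') :=
    ⟨hF.iii_a ε.hom p' (isCoAngular_of_isIso F hC ε.hom) hp'.1,
      IsPreStep.comp F (isPreStep_of_isIso F ε.hom) hp'.2⟩
  obtain ⟨γ, hγ, hγ'⟩ := hF.v_b_unique (p ≫ α) p α (ε.hom ≫ p') α' rfl hp hα
    (by rw [Category.assoc, hδ]) hεp' hα'
  refine ⟨γ, ?_, hγ'⟩
  rw [← hgp, Category.assoc, hγ, ← Category.assoc, hε, hgp']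

/-- **Prop. 1.9 (i)**: in a factorisation `φ = α ∘ β` as above, "`φ` is isometric if and only if
`β` is a morphism of Frobenius type" (Remark 1.1.1: `Div(φ) = Div(β)` since `α` is an isometric
pre-step). [cite: MochizukiFrdI2008, Prop. 1.9(i) p.31] -/
theorem isIsometry_iff_isFrobeniusType_of_factorization {A B X : C} (φ : A ⟶ B) (β : A ⟶ X)
    (α : X ⟶ B) (hfac : β ≫ α = φ) (hβ : IsCoAngular F β ∧ IsBaseIso F β)
    (hα : IsIsometricPreStep F α) : IsIsometry F φ ↔ IsFrobeniusType F β := by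
  have hdiv : Div F φ = Div F β := by
    rw [← hfac, div_comp, show Div F α = 1 from hα.1, map_one, one_mul,
      show degFr F α = 1 from hα.2.1, PNat.one_coe, pow_one]
  constructor
  · intro h
    exact ⟨⟨hβ.1, show Div F β = 1 by rw [← hdiv]; exact h⟩, hβ.2⟩
  · intro h
    show Div F φ = 1
    rw [hdiv]
    exact h.1.2

/-- **Prop. 1.9 (i)**: in a factorisation `φ = α ∘ β` as above, "`φ` is co-angular if and only if
`α` is an isomorphism" (the definition of "co-angular" applied to `φ = id ∘ α ∘ β`; conversely
co-angular morphisms are closed under composition). [cite: MochizukiFrdI2008, Prop. 1.9(i) p.31] -/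
theorem isCoAngular_iff_isIso_of_factorization (hF : IsFrobenioid F) {A B X : C} (φ : A ⟶ B)
    (β : A ⟶ X) (α : X ⟶ B) (hfac : β ≫ α = φ) (hβ : IsCoAngular F β ∧ IsBaseIso F β)
    (hα : IsIsometricPreStep F α) : IsCoAngular F φ ↔ IsIso α := by
  have hC : IsTotallyEpimorphic C := hF.isPreFrobenioid.isTotallyEpimorphic
  constructor
  · intro h
    exact h β α (𝟙 B) (by rw [Category.comp_id, hfac]) (degFr_id F B) hα.1 hα.2
      (Or.inl (isBaseIso_of_isIso F (𝟙 B)))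
  · intro h
    rw [← hfac]
    exact hF.iii_a β α hβ.1 (isCoAngular_of_isIso F hC α)

/-- **Prop. 1.9 (i)**: a base-isomorphism "`φ` is a pull-back morphism if and only if `φ` is an
isomorphism" ("pull-backs which are base-isomorphisms are easily verified to be isomorphisms
[cf. Remark 1.2.1]"). [cite: MochizukiFrdI2008, Prop. 1.9(i) p.31] -/
theorem isPullbackMorphism_iff_isIso_of_isBaseIso {A B : C} (φ : A ⟶ B) (hφ : IsBaseIso F φ) :
    IsPullbackMorphism F φ ↔ IsIso φ :=
  ⟨fun h => (isPullbackMorphism_and_isBaseIso_iff_isIso F φ).mp ⟨h, hφ⟩,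
    fun _ => isPullbackMorphism_of_isIso F φ⟩

/-! ### Isotropic objects and isotropic hulls: formal preliminaries -/

/-- Isotropy is invariant under isomorphism. [cite: MochizukiFrdI2008, Def. 1.2(iv)] -/
theorem IsIsotropic.of_iso (hP : IsPreFrobenioid Φ F) {A A' : C} (e : A ≅ A')
    (h : IsIsotropic F A') : IsIsotropic F A := by
  intro X ψ hψ₁ hψ₂
  have h' : IsIsometricPreStep F (e.inv ≫ ψ) :=
    IsIsometricPreStep.comp F (isIsometricPreStep_of_isIso hP e.inv) ⟨hψ₁, hψ₂⟩
  haveI : IsIso (e.inv ≫ ψ) := h (e.inv ≫ ψ) h'.1 h'.2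
  have : ψ = e.hom ≫ e.inv ≫ ψ := by simp
  rw [this]
  infer_instance

/-- An isotropic hull followed by an isomorphism is an isotropic hull.
[cite: MochizukiFrdI2008, Def. 1.2(iv)] -/
theorem IsIsotropicHull.comp_iso (hP : IsPreFrobenioid Φ F) {A B B' : C} {φ : A ⟶ B}
    (hφ : IsIsotropicHull F φ) (e : B ≅ B') : IsIsotropicHull F (φ ≫ e.hom) := by
  obtain ⟨hφ₁, hφ₂, hB, huniv⟩ := hφ
  have he : IsIsometricPreStep F e.hom := isIsometricPreStep_of_isIso hP e.hom
  refine ⟨IsIsometry.comp F hφ₁ he.1, IsPreStep.comp F hφ₂ he.2, IsIsotropic.of_iso hP e.symm hB,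
    fun X γ hX => ?_⟩
  obtain ⟨β, hβ, hβu⟩ := huniv γ hX
  refine ⟨e.inv ≫ β, by simpa using hβ, fun β' hβ' => ?_⟩
  have : e.hom ≫ β' = β := hβu _ (by simpa using hβ')
  rw [← this, e.inv_hom_id_assoc]

/-- Isotropic hulls of the same object are isomorphic under it ("necessarily unique, up to unique
isomorphism", Def. 1.3 (vii)(a)). [cite: MochizukiFrdI2008, Def. 1.3(vii)] -/
theorem IsIsotropicHull.unique (hC : IsTotallyEpimorphic C) {A B B' : C} {φ : A ⟶ B} {φ' : A ⟶ B'}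
    (hφ : IsIsotropicHull F φ) (hφ' : IsIsotropicHull F φ') : ∃ e : B ≅ B', φ ≫ e.hom = φ' := by
  obtain ⟨b, hb, -⟩ := hφ.2.2.2 φ' hφ'.2.2.1
  obtain ⟨b', hb', -⟩ := hφ'.2.2.2 φ hφ.2.2.1
  haveI := hC.epi φ
  haveI := hC.epi φ'
  have h1 : b ≫ b' = 𝟙 B := by
    rw [← cancel_epi φ, ← Category.assoc, hb, hb', Category.comp_id]
  have h2 : b' ≫ b = 𝟙 B' := by
    rw [← cancel_epi φ', ← Category.assoc, hb', hb, Category.comp_id]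
  exact ⟨⟨b, b', h1, h2⟩, hb⟩

/-! ### Proposition 1.9 (iv) -/

/-- **Prop. 1.9 (iv)**: for a co-angular linear `φ : A → B` (e.g. a pull-back morphism), `A` is
isotropic iff `B` is (`⇒` is Def. 1.3 (vii)(b); `⇐`: factor `φ` through an isotropic hull
`α : A → A'`, Def. 1.3 (vii)(a) — then co-angularity of `φ = β ∘ α ∘ id` forces `α` to be an
isomorphism). [cite: MochizukiFrdI2008, Prop. 1.9(iv) p.31] -/
theorem isIsotropic_iff_of_isCoAngular_isLinear (hF : IsFrobenioid F) {A B : C} (φ : A ⟶ B)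
    (hco : IsCoAngular F φ) (hlin : IsLinear F φ) : IsIsotropic F A ↔ IsIsotropic F B := by
  have hP : IsPreFrobenioid Φ F := hF.isPreFrobenioid
  refine ⟨fun hA => hF.vii_b φ hA, fun hB => ?_⟩
  obtain ⟨A', α, hα⟩ := hF.vii_a A
  obtain ⟨β, hβ, -⟩ := hα.2.2.2 φ hB
  have hβlin : IsLinear F β := by
    have h : IsLinear F (α ≫ β) := by rw [hβ]; exact hlin
    exact (isLinear_factors F h).1
  haveI : IsIso α := hco (𝟙 A) α β (by rw [Category.id_comp, hβ]) hβlin hα.1 hα.2.1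
    (Or.inr (isBaseIso_of_isIso F (𝟙 A)))
  exact IsIsotropic.of_iso hP (asIso α) hα.2.2.1

/-- **Prop. 1.9 (iv)**, "[e.g., a pull-back morphism — cf. Proposition 1.4, (ii)]": the domain
of a pull-back morphism is isotropic iff its codomain is. [cite: MochizukiFrdI2008, Prop. 1.9(iv) p.31] -/
theorem isIsotropic_iff_of_isPullbackMorphism (hF : IsFrobenioid F) {A B : C} (φ : A ⟶ B)
    (hφ : IsPullbackMorphism F φ) : IsIsotropic F A ↔ IsIsotropic F B :=
  isIsotropic_iff_of_isCoAngular_isLinear hF φ (hF.iv_b φ hφ).1.1 (hF.iv_b φ hφ).2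

/-! ### Proposition 1.9 (vi) -/

/-- **Prop. 1.9 (vi)**: `φ : A → B` is an isotropic hull iff `B` is isotropic and `φ` is
minimal-coadjoint to the morphisms with isotropic domain (necessity from the universal property of
the hull and total epimorphicity; sufficiency from the existence of hulls, Def. 1.3 (vii)(a)).
[cite: MochizukiFrdI2008, Prop. 1.9(vi) p.32] -/
theorem isIsotropicHull_iff_isMinimalCoadjoint (hF : IsFrobenioid F) {A B : C} (φ : A ⟶ B) :
    IsIsotropicHull F φ ↔
      IsIsotropic F B ∧ IsMinimalCoadjoint (fun X _ (_ : X ⟶ _) => IsIsotropic F X) φ := by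
  have hP : IsPreFrobenioid Φ F := hF.isPreFrobenioid
  have hC : IsTotallyEpimorphic C := hP.isTotallyEpimorphic
  constructor
  · intro hφ
    refine ⟨hφ.2.2.1, fun X α β hfac hX => ?_⟩
    -- the universal property gives `a : B → X` with `φ ≫ a = α`; then `a`, `β` are inverse
    obtain ⟨a, ha, -⟩ := hφ.2.2.2 α hX
    obtain ⟨c, -, hcu⟩ := hφ.2.2.2 φ hφ.2.2.1
    have h1 : a ≫ β = 𝟙 B :=
      (hcu (a ≫ β) (show φ ≫ a ≫ β = φ by rw [← Category.assoc, ha, hfac])).trans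
        (hcu (𝟙 B) (Category.comp_id φ)).symm
    haveI := hC.epi α
    have h2 : β ≫ a = 𝟙 X := by
      rw [← cancel_epi α, ← Category.assoc, hfac, ha, Category.comp_id]
    exact ⟨⟨a, h2, h1⟩⟩
  · rintro ⟨hB, hmin⟩
    obtain ⟨A', h, hh⟩ := hF.vii_a A
    obtain ⟨b, hb, -⟩ := hh.2.2.2 φ hB
    haveI : IsIso b := hmin h b hb hh.2.2.1
    rw [← hb]
    exact IsIsotropicHull.comp_iso hP hh (asIso b)

/-! ### Proposition 1.9 (vii) -/

/-- **Prop. 1.9 (vii)**, necessity: an isometric pre-step `φ : A → B` composed with ANY isotropic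
hull `χ : B → C` is an isotropic hull of `A` (compare with a hull `h : A → A″`: the induced
`A″ → C` is an isometric pre-step between isotropic objects, hence an isomorphism).
[cite: MochizukiFrdI2008, Prop. 1.9(vii) p.32] -/
theorem IsIsometricPreStep.comp_isIsotropicHull (hF : IsFrobenioid F) {A B X : C} {φ : A ⟶ B}
    (hφ : IsIsometricPreStep F φ) {χ : B ⟶ X} (hχ : IsIsotropicHull F χ) :
    IsIsotropicHull F (φ ≫ χ) := by
  have hP : IsPreFrobenioid Φ F := hF.isPreFrobenioid
  obtain ⟨A'', h, hh⟩ := hF.vii_a A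
  obtain ⟨c, hc, -⟩ := hh.2.2.2 (φ ≫ χ) hχ.2.2.1
  -- `c` is an isometric pre-step (two out of three) out of the isotropic object `A''`
  have hφχ : IsIsometricPreStep F (φ ≫ χ) := IsIsometricPreStep.comp F hφ ⟨hχ.1, hχ.2.1⟩
  have hc' : IsIsometricPreStep F c :=
    IsIsometricPreStep.of_comp_left hP (f := h) (by rw [hc]; exact hφχ)
  haveI : IsIso c := hh.2.2.1 c hc'.1 hc'.2
  rw [← hc]
  exact IsIsotropicHull.comp_iso hP hh (asIso c)

/-- **Prop. 1.9 (vii)**, sufficiency: if the composite of `φ : A → B` with SOME isotropic hull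
`χ : B → C` (indeed with any arrow `χ`) is an isotropic hull of `A`, then `φ` is an isometric
pre-step (two out of three for isometries and pre-steps, Prop. 1.7 (v)).
[cite: MochizukiFrdI2008, Prop. 1.9(vii) p.32] -/
theorem isIsometricPreStep_of_comp_isIsotropicHull (hP : IsPreFrobenioid Φ F) {A B X : C}
    {φ : A ⟶ B} {χ : B ⟶ X} (h : IsIsotropicHull F (φ ≫ χ)) :
    IsIsometricPreStep F φ := by
  have hφχ : IsIsometricPreStep F (φ ≫ χ) := ⟨h.1, h.2.1⟩
  exact IsIsometricPreStep.of_comp_right hP (g := χ) hφχ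

/-- **Prop. 1.9 (vii)**: in a Frobenioid, `φ : A → B` is an isometric pre-step iff its composite
with every (equivalently, by Def. 1.3 (vii)(a), some) isotropic hull `B → C` is an isotropic hull
`A → C`. [cite: MochizukiFrdI2008, Prop. 1.9(vii) p.32] -/
theorem isIsometricPreStep_iff_comp_isIsotropicHull (hF : IsFrobenioid F) {A B : C} (φ : A ⟶ B) :
    IsIsometricPreStep F φ ↔
      ∀ ⦃X : C⦄ (χ : B ⟶ X), IsIsotropicHull F χ → IsIsotropicHull F (φ ≫ χ) := by
  refine ⟨fun hφ X χ hχ => hφ.comp_isIsotropicHull hF hχ, fun h => ?_⟩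
  obtain ⟨X, χ, hχ⟩ := hF.vii_a B
  exact isIsometricPreStep_of_comp_isIsotropicHull hF.isPreFrobenioid (h χ hχ)

end PreFrobenioid

end Literature.AlgebraicGeometry.Frobenioids
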